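import Summits.Ventures.YMGap.Thresholds.RegionPoincare
import Summits.Ventures.YMGap.Thresholds.SharpMassGap
import HarnessLib

/-!
# Venture YMGap — the mass gap at the sharp window from a uniform-Poincaré ⇒ mixing principle

HONEST FRAMING: venture file (cell `pub-ymgap`, track (a), seat p2). Packaging for the next step of the
A2 line. `RegionPoincare.lean` proves — hypothesis-free — the UNIFORM Poincaré inequality of the DLR kernels
of 't Hooft-scaled `SU(N)` lattice Yang–Mills at every `|β| < 1/(8d)` (`UniformKernelPoincare`, packaged
here; `uniformKernelPoincare_sharp`). Stroock–Zegarlinski (J. Funct. Anal. 104 (1992) 299–326; CMP 144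
(1992) 303–323) prove for compact continuous spins with finite-range interactions that a uniform Poincaré
inequality (uniform in volume and boundary condition) is EQUIVALENT to the uniform log-Sobolev inequality
and to Dobrushin–Shlosman mixing, hence gives uniqueness of the Gibbs state and exponential clustering.
That printed theorem is NOT yet typed in the tree; this file isolates the exact shape in which it is
needed (`PoincareMixingPrinciple`, a HYPOTHESIS SHAPE, not a named fact and not claimed here) and proves:
`PoincareMixingPrinciple d N → MassGapBelow d N (1/(8d))` for all `N ≥ 1`, `d ≥ 1`, and
`→ ImprovedThreshold d N (1/(8d))` for `d ≥ 3` (`improvedThreshold_sharp_of_poincarePrinciple`). Once a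
literature seat types the Stroock–Zegarlinski equivalence AS PRINTED and it is shown to imply
`PoincareMixingPrinciple d N`, the cell's track-(a) target type at the sharp window becomes
K-conditional on that ONE printed fact (today: three — `improvedThreshold_sharp`). WHAT IT IS NOT: no
claim that the principle holds; no new number.

## References

* D. W. Stroock, B. Zegarlinski, J. Funct. Anal. 104 (1992) 299–326; Commun. Math. Phys. 144 (1992)
  303–323 (uniform PI ⇔ uniform LSI ⇔ DS mixing for compact continuous spins; cf. arXiv:1410.3924 §1).
* H. Shen, R. Zhu, X. Zhu, CMP 400 (2023) 805–851, Remark 1.3, Cor. 4.11.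
-/

noncomputable section

open scoped Matrix ComplexConjugate BigOperators Matrix.Norms.Frobenius ContDiff Topology ProbabilityTheory
open Matrix Complex Finset MeasureTheory Filter ProbabilityTheory
open Literature.MathematicalPhysics.QuantumFieldTheory
open Literature.MathematicalPhysics.QuantumLattice (fundamentalRep LGConfig ymSpecification)
open Literature.MathematicalPhysics.QuantumFieldTheory.SUNBakryEmery (SUN)

namespace Summit.Ventures.YMGap

namespace LatticeBakryEmery

variable {d N : ℕ}

variable (d N) in
/-- **Uniform kernel Poincaré inequality** (in volume AND boundary condition) at 't Hooft coupling `β`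
with constant `1/K`, Lipschitz form: for every finite edge set `E`, exterior `η`, smooth `f` that is
`L_e`-Lipschitz in the link `e` on `SU(N)^E`, `Var_{γ_E(·|η)}(f((U_e)_{e∈E})) ≤ (1/K) ∑_e L_e²`.
(Hypothesis/conclusion SHAPE; proved below at `K = N/2 - 4dN|β|`.) -/
def UniformKernelPoincare (β K : ℝ) : Prop :=
  ∀ (E : Finset (Literature.MathematicalPhysics.QuantumFieldTheory.ZdEdge d)) (η : LGConfig d (SUN N))
    (f : Cfg ↥E N → ℝ), ContDiff ℝ ∞ f → ∀ (Lc : ↥E → ℝ), (∀ e, 0 ≤ Lc e) → LinkLipschitz f Lc →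
      Var[matrixCylinder E f; ymSpecification (fundamentalRep (Fin N)) ((N : ℝ) * β) E η] ≤ 1 / K * ∑ e, Lc e ^ 2

/-- The uniform kernel Poincaré inequality from any regional Hessian constant (kernel theorem). -/
theorem uniformKernelPoincare_of_regionHessianBound {Λ₀ : ℝ} (hH : RegionWilsonHessianBound d N Λ₀) (hN : N ≠ 0)
    (β : ℝ) (hK : 0 < (N : ℝ) / 2 - N * |β| * Λ₀) :
    UniformKernelPoincare d N β ((N : ℝ) / 2 - N * |β| * Λ₀) :=
  fun E η _ hf _ hL hLip => kernel_variance_le hH hN β hK E η hf hL hLip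

/-- **The uniform kernel Poincaré inequality at the sharp window** `|β| < 1/(8d)`, `K = N/2 - 4dN|β|`,
all `N ≥ 1`, `d ≥ 1` — hypothesis-free kernel theorem. -/
theorem uniformKernelPoincare_sharp (hd : 1 ≤ d) (hN : 1 ≤ N) {β : ℝ} (hβ : |β| < HessianSharp.sharpThresholdSU d) :
    UniformKernelPoincare d N β (HessianSharp.sharpBakryEmeryConstSU N d β) :=
  fun E η _ hf _ hL hLip => uniform_kernel_poincare_sharp hd hN hβ E η hf hL hLip

variable (d N) in
/-- **The uniform-Poincaré ⇒ mixing principle** (HYPOTHESIS SHAPE — the form in which the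
Stroock–Zegarlinski equivalence "uniform PI ⇔ uniform LSI ⇔ Dobrushin–Shlosman mixing" for compact
continuous spins is needed; NOT a named fact, NOT claimed): a uniform kernel Poincaré inequality with a
positive constant at coupling `β` forces a unique DLR state and exponential clustering (SZZ form) of
every tight limit at `β`. -/
def PoincareMixingPrinciple : Prop :=
  ∀ (β K : ℝ), 0 < K → UniformKernelPoincare d N β K →
    Literature.Probability.LatticeModels.HasUniqueGibbsMeasure
        (ymSpecification (d := d) (fundamentalRep (Fin N)) ((N : ℝ) * β)) ∧
      SZZExponentialClustering d N β

/-- **Mass gap on the whole sharp window from the principle**: `PoincareMixingPrinciple d N` and the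
kernel uniform Poincaré inequality give `MassGapBelow d N (1/(8d))` for all `N ≥ 1`, `d ≥ 1`. -/
theorem massGapBelow_sharp_of_poincarePrinciple (hP : PoincareMixingPrinciple d N) (hd : 1 ≤ d) (hN : 1 ≤ N) :
    MassGapBelow d N (HessianSharp.sharpThresholdSU d) := by
  intro β hβ
  have hK : 0 < HessianSharp.sharpBakryEmeryConstSU N d β := (HessianSharp.sharpBakryEmeryConstSU_pos_iff hd hN β).2 hβ
  obtain ⟨hu, hc⟩ := hP β _ hK (uniformKernelPoincare_sharp hd hN hβ)
  exact HessianSharp.massGapAt_of_hasUniqueGibbsMeasure hu hc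

/-- **The track-(a) target type from ONE principle**: for `d ≥ 3`, `N ≥ 1`,
`PoincareMixingPrinciple d N → ImprovedThreshold d N (1/(8d))` (the window `1/(8d)` strictly exceeds
Shen–Zhu–Zhu's `1/(16(d-1))`). When the Stroock–Zegarlinski equivalence is typed as a named fact
implying the principle, this replaces the three-fact `improvedThreshold_sharp`. -/
theorem improvedThreshold_sharp_of_poincarePrinciple (hP : PoincareMixingPrinciple d N) (hd : 3 ≤ d) (hN : 1 ≤ N) :
    ImprovedThreshold d N (HessianSharp.sharpThresholdSU d) :=
  ⟨HessianSharp.szzThresholdSU_lt_sharpThresholdSU hd,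
    massGapBelow_sharp_of_poincarePrinciple hP (le_trans (by norm_num) hd) hN⟩

end LatticeBakryEmery

end Summit.Ventures.YMGap
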